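import Mathlib
import HarnessLib
import Summits.AnomalousDissipation.AnomalousDissipation.Theses.DecimationAxis

/-!
# Birth skeleton (BC3) for the crux `DecimationAxis.UniformEquilibration`
(item stmt-AnomalousDissipation-1583; route route-AnomalousDissipation-DecimationAxis, crux r3) —
skeleton registrar planner-skel-stmt-AnomalousDissipation-1583-0, 2026-08-17.

The crux (`Summit.AnomalousDissipation.AnomalousDissipation.Theses.DecimationAxis.UniformEquilibration`):
for every viscosity `ν > 0`, every band-limited real transversal force family `g`
(`IsConjSymm g`, `g` supported in `freqBall N`, `g 0 = 0`, `k · g k = 0`), budgets `E`, `ε > 0` and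
resolution wavenumber `M` there are `T₀`, `R` such that FOR EVERY truncation `K`,
`S = freqBall K ∖ {0}`: if SOME global trajectory of the exact-coupling Galerkin system `galerkinRHS S ν g↾S`
has `longTimeAvgSup` energy `≤ E` and `longTimeAvgInf` resolved dissipation
`ν·4π²·Σ_{|k|≤M}|k|²‖c_k‖² ≥ 2ε`, then SOME trajectory started from a datum with
`Σ(1+|k|²)‖c(0)_k‖² ≤ R` has running means `timeMean energy ≤ 2E` and
`timeMean resolved dissipation ≥ ε` for ALL `T ≥ T₀`. Per `K` this is trivial (shift the premise
trajectory); the content is the `K`-UNIFORMITY of `(T₀, R)` at fixed `ν` (route header; refuter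
route-reviews 2026-08-15; grounder g20-36: "R is never the obstruction, T₀ is").

## The seam: ABSORB → SETTLE (`K`-uniformly) → RESTART FROM A TAME INSTANT

Any proof must (1) put the Floor witness into the `K`-uniform absorbing ball of the Galerkin
dynamics (Poincaré on `S ∌ 0` + exact energy identity), (2) produce a witness whose TWO running means
have settled, with margins, by a `K`-UNIFORM time `T₁` — the whole open content, in the two-scalar
normal form of the second refuter review ("UniformEquilibration ⟺ K-uniform bounds on T₁ and s*") —
and (3) restart that witness at a nearby instant of small enstrophy (time-averaged enstrophy over a
unit window is bounded by the energy identity, `K`-uniformly inside the ball), paying for the restart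
only with the margins. The skeleton is cut exactly there — three registered stubs, all consumed by
`UniformEquilibration_of`:

* `stub_absorbedWitness` (provable now; size M). For `ν > 0` and an admissible `g` there is ONE
  radius-squared `B = B(ν, g)` such that for all budgets, resolutions and truncations `K`: if some
  trajectory on `S = freqBall K ∖ {0}` has the Floor asymptotics (`longTimeAvgSup` energy `≤ E`,
  `longTimeAvgInf` resolved dissipation `≥ 2ε`), then some trajectory that stays in the energy ball
  `Σ‖c(t)_k‖² ≤ B` for all `t ≥ 0` has the same asymptotics. Proof in print: along any trajectory
  `d/dt Σ‖c‖² = 2(−ν·4π²Σ|k|²‖c_k‖² + Re Σ⟨g_k, c_k⟩) ≤ −8π²ν e + 2 G_N e^{1/2}`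
  (`hasDerivWithinAt_energy`, `|k|² ≥ 1` on `S ∌ 0` by `one_le_freqNormSq_of_ne_zero`,
  `G_N² = Σ_{freqBall N}‖g_k‖²` bounds the force on every `S`), so the ball `B = (G_N/(4π²ν))² + 1`
  is entered in finite time and never left (barrier argument, as in the tree's
  `Theorems/MomentParityQuarticTightnessStubAbsorbingBall.lean`); shift the trajectory to its
  entrance time (autonomy: `IsGalerkinODESolution.comp_add`), which does not change long-time
  `limsup`/`liminf` averages of nonnegative locally integrable observables
  (`longTimeAvgSup_comp_add_right`; the `liminf` twin is the same computation).
* `stub_uniformSettling` (THE RESIDUE — open, size XL, load-bearing). For `ν > 0`, admissible `g`,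
  budgets `E`, `ε > 0`, resolution `M` and a ball radius `B` there are a SETTLING TIME `T₁`, MARGINS
  `E₁ < 2E`, `ε₁ > ε` and a radius `B₁`, all INDEPENDENT OF `K`, such that for every truncation `K`:
  if some trajectory in the ball `B` (from time `0`) has the Floor asymptotics, then some trajectory
  in the ball `B₁` has `timeMean energy ≤ E₁` AND `timeMean resolved dissipation ≥ ε₁` for ALL
  `T ≥ T₁`. This is the crux's dynamical content with the datum clause stripped off and the
  thresholds relaxed to the weakest the composition needs (existential margins, typing checklist
  (iv)); it is NOT the crux reworded — no `H¹` datum, no `(2E, ε)`, a from-time-zero sup-energy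
  clause instead — and it gives the crux back only through `stub_tameRestart` (BC3 probes fail, see
  the seat's NOTES.md). Why it might fail = why the crux might: near-heteroclinic cycling with
  passage times growing in `K`, or relaxation at truncation scales `k ∼ K`, could force `T₁(K) → ∞`
  for every admissible witness (Holmes–Lumley–Berkooz–Rowley 2012 §9.2; cards
  cycling-loophole-rate-vs-level, hyperfinite-hull N3); the physics bet is "a few large-eddy
  turnovers suffice at any resolution" (KanedaEtAl2003 plateaux reached after O(1) turnover times at
  every resolution). First attack named by the reviews: rising-sun/argmin selection gives `T₁`-free
  control of ONE observable (from the minimiser `s*` of `∫₀ᵀ(D − 3ε/2)` every forward mean of `D` is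
  `≥ 3ε/2`), so the residue is equivalently a `K`-uniform bound on the two scalars
  `(T₁^energy, s*)` of SOME witness in the ball.
* `stub_tameRestart` (provable now; size M). For `ν > 0`, admissible `g`, `E`, `ε > 0`, `M` and ANY
  `(T₁, E₁, ε₁, B₁)` with `E₁ < 2E`, `ε < ε₁` there are `T₀`, `R` (depending on these and on
  `G_N`, NOT on `K`) such that for every `K`: a trajectory in the ball `B₁` whose two running means
  have settled to `(E₁, ε₁)` from `T₁` on yields a trajectory from a datum with
  `Σ(1+|k|²)‖c(0)_k‖² ≤ R` whose running means obey `(2E, ε)` from `T₀` on. Proof in print: by the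
  energy identity on `[0,1]` (`galerkin_energy_identity`, `toReal_eGradNormSq_coeffExt`),
  `4π²ν∫₀¹Σ|k|²‖c_k‖² ≤ B₁/2 + G_N B₁^{1/2}`, so some `s ∈ [0,1]` has enstrophy below that bound
  (mean-value/`exists_le_integral`-type selection for the continuous enstrophy) and
  `R := B₁ + (B₁/2 + G_N B₁^{1/2})/(4π²ν)` works; restart there (`comp_add`); for `T ≥ T₀`,
  `T⁻¹∫ₛ^{s+T} e ≤ (1 + 1/T) E₁ ≤ 2E` and `T⁻¹∫ₛ^{s+T} D ≥ ε₁ − D_max/T ≥ ε` with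
  `D_max = 4π²νM²B₁` (`timeMean_comp_add_right`, `intervalIntegral.integral_add_adjacent_intervals`),
  `T₀ := max T₁ 0 + 1 + E₁⁺/(2E − E₁) + D_max/(ε₁ − ε)`. Degenerate parameters (`E₁ < 0`, `B₁ < 0`,
  `T₁ ≤ 0` with `ε₁ > 0` at `T = 0` where `timeMean = 0`) make the hypothesis unsatisfiable, so the
  statement stays true as typed.

`UniformEquilibration_of : Sig.stub_absorbedWitness → Sig.stub_uniformSettling → Sig.stub_tameRestart →
UniformEquilibration` concludes the route decl BY NAME and is proved sorry-free by composition (pure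
logic: the crux premise is repacked into the vocabulary below, which is the crux's own lambda terms
named). `UniformEquilibration_proof : UniformEquilibration` is the skeleton in its final shape (depends
on `sorryAx` through the three stubs only).

## Disproof used

No `Cruxes/UniformEquilibration/Disproof.lean` and no `Theorems/UniformEquilibration/Negative/*` exist
(2026-08-17, `ledger crux ls stmt-AnomalousDissipation-1583`: no workfiles) — none to honour. The
refuters' standing observations are honoured structurally: "per K trivial, content = K-uniformity of
T₀" is isolated as `stub_uniformSettling`; "R is never the obstruction" is `stub_tameRestart`
(provable); "WLOG in the absorbing ball" is `stub_absorbedWitness` (provable). `ledger negatives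
--problem AnomalousDissipation`: no stub is an instance of a refuted statement (the refuted ceilings
range over ALL solutions of a force; every stub here is a witness statement at fixed `ν`).

## BC3 audit (this seat; raw outputs in the seat's NOTES.md `birth-certificate:`)

`lean check --json` rc 0 with `sorry` exactly in `stub_absorbedWitness`, `stub_uniformSettling`,
`stub_tameRestart` (sorry count 3 = stub count, zero elsewhere); probes `stub → UniformEquilibration`
and `stub → AnomalousDissipation` by `first | exact? | simpa [stub] | (unfold stub; simpa) | aesop`
FAIL for all three stubs (6/6), file `bc/UniformEquilibration_stub_probes.lean` of the seat folder
(vocabulary + `Sig.*` copied, no sorried theorem in scope).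
-/

set_option linter.dupNamespace false

noncomputable section

namespace Summit.AnomalousDissipation.AnomalousDissipation.Cruxes.UniformEquilibration.Birth

open scoped BigOperators Topology Classical MeasureTheory InnerProductSpace ComplexConjugate
open Filter Set Function MeasureTheory
open Literature.Analysis.FunctionSpaces Literature.Analysis.FunctionSpaces.Torus
open Literature.Analysis.FluidPDE
open Summit.AnomalousDissipation.AnomalousDissipation.Theses.DecimationAxis

/-- Integer frequencies (local notation). -/
local notation "ℤ³" => Fin 3 → ℤ
/-- Complex Fourier coefficient vectors (local notation). -/
local notation "ℂ³" => EuclideanSpace ℂ (Fin 3)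

/-! ### §0 Vocabulary of the seam (plain `def`s naming the crux's own lambda terms) -/

/-- `IsCoeffTrajectory S ν g c`: the crux's solution notion, verbatim — a global trajectory of the
exact-coupling Galerkin system on `S` at viscosity `ν` driven by `g↾S`: values in the Galerkin phase
space, continuous on `[0, ∞)`, solving `ċ = galerkinRHS S ν g↾S c` on every `[0, T]` (one-sided
derivatives at the endpoints). Equivalently `IsGalerkinODESolution ν (g↾S) (c 0) c` (tree,
`GalerkinFlow.lean`) minus its `rfl` datum clause. -/
def IsCoeffTrajectory (S : Finset ℤ³) (ν : ℝ) (g : ℤ³ → ℂ³) (c : ℝ → ↥S → ℂ³) : Prop :=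
  (∀ t, c t ∈ galerkinSubspace S) ∧ ContinuousOn c (Set.Ici 0) ∧
    ∀ T : ℝ, ∀ t ∈ Set.Icc (0 : ℝ) T,
      HasDerivWithinAt c (galerkinRHS S ν (fun k => g k) (c t)) (Set.Icc 0 T) t

/-- Modal energy `Σ_{k∈S} ‖a_k‖²` (`= ∫‖u‖²` for `u = realTrigPoly S ā`; the crux's energy
observable, verbatim). -/
def modalEnergy {S : Finset ℤ³} (a : ↥S → ℂ³) : ℝ :=
  ∑ k : ↥S, ‖a k‖ ^ 2

/-- Resolved dissipation below wavenumber `M` at viscosity `ν`: `ν·4π²·Σ_{|k|≤M} |k|²‖a_k‖²`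
(the crux's dissipation observable, verbatim). -/
def resolvedDissipation {S : Finset ℤ³} (ν : ℝ) (M : ℕ) (a : ↥S → ℂ³) : ℝ :=
  ν * (4 * Real.pi ^ 2 * ∑ k : ↥S,
    if freqNormSq (k : ℤ³) ≤ (M : ℝ) ^ 2 then freqNormSq (k : ℤ³) * ‖a k‖ ^ 2 else 0)

/-- The `H¹`-type size of a datum, `Σ_{k∈S} (1+|k|²)‖a_k‖²` (the crux's datum clause, verbatim). -/
def h1Size {S : Finset ℤ³} (a : ↥S → ℂ³) : ℝ :=
  ∑ k : ↥S, (1 + freqNormSq (k : ℤ³)) * ‖a k‖ ^ 2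

/-! ### §1 Stub signatures (`Sig.stub_*`, so that the hypothesis heads of `UniformEquilibration_of`
carry the registered stub names) -/

/-- STUB 1 — THE FLOOR WITNESS MAY BE TAKEN INSIDE THE `K`-UNIFORM ABSORBING BALL (provable now, M).
For `ν > 0` and an admissible force family `g` (the crux's four hypotheses) there is ONE `B` such that
for all `E ε M K` and `S = freqBall K ∖ {0}`: a trajectory with `longTimeAvgSup` energy `≤ E` and
`longTimeAvgInf` resolved dissipation `≥ 2ε` can be replaced by one with the same two asymptotic
bounds which stays in the energy ball `Σ‖c(t)_k‖² ≤ B` for all `t ≥ 0`. Intended proof: absorbing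
ball `B = (G_N/(4π²ν))² + 1`, `G_N² = Σ_{k ∈ freqBall N}‖g k‖²` (energy inequality
`ė ≤ −8π²ν e + 2G_N√e` from `hasDerivWithinAt_energy` and Poincaré `|k|² ≥ 1` on `S ∌ 0`), entered
in finite time and forward invariant; time shift to the entrance time
(`IsGalerkinODESolution.comp_add`); shift invariance of `longTimeAvgSup`/`longTimeAvgInf` of
nonnegative locally integrable observables (`longTimeAvgSup_comp_add_right` and its `liminf` twin).
Sources: ConstantinFoias1988 Ch. 8 (8.7)–(8.9); Temam1997 Ch. III §2.2; DoeringFoias2002 §2. -/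
def Sig.stub_absorbedWitness : Prop :=
  ∀ (ν : ℝ), 0 < ν → ∀ (N : ℕ) (g : ℤ³ → ℂ³), IsConjSymm g → (∀ k, k ∉ freqBall N → g k = 0) →
    g 0 = 0 → (∀ k : ℤ³, ∑ i, ((k i : ℤ) : ℂ) * g k i = 0) →
    ∃ B : ℝ, ∀ (E ε : ℝ) (M K : ℕ) (S : Finset ℤ³), S = (freqBall K).erase 0 →
      (∃ c : ℝ → ↥S → ℂ³, IsCoeffTrajectory S ν g c ∧
          longTimeAvgSup (fun t => modalEnergy (c t)) ≤ E ∧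
          2 * ε ≤ longTimeAvgInf (fun t => resolvedDissipation ν M (c t))) →
      ∃ c : ℝ → ↥S → ℂ³, IsCoeffTrajectory S ν g c ∧ (∀ t, 0 ≤ t → modalEnergy (c t) ≤ B) ∧
          longTimeAvgSup (fun t => modalEnergy (c t)) ≤ E ∧
          2 * ε ≤ longTimeAvgInf (fun t => resolvedDissipation ν M (c t))

/-- STUB 2 — `K`-UNIFORM TWO-SIDED SETTLING INSIDE THE BALL (THE RESIDUE; open, XL, load-bearing).
For `ν > 0`, admissible `g`, budgets `E`, `ε > 0`, resolution `M` and a radius `B` there are a settling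
time `T₁`, margins `E₁ < 2E`, `ε₁ > ε` and a radius `B₁`, INDEPENDENT OF THE TRUNCATION, such that for
every `K`, `S = freqBall K ∖ {0}`: if some trajectory staying in the ball `B` has `longTimeAvgSup`
energy `≤ E` and `longTimeAvgInf` resolved dissipation `≥ 2ε`, then some trajectory staying in the
ball `B₁` has `timeMean energy ≤ E₁` and `timeMean resolved dissipation ≥ ε₁` for ALL `T ≥ T₁`.
Per `K` trivial (the premise trajectory itself settles to within any margin of `(E, 2ε)`); the
content is the `K`-uniformity of `T₁` — the dynamical heart of the crux, in the two-scalar normal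
form of the route reviews (rising-sun/argmin selection makes the dissipation side `T₁`-free, so what
remains is a `K`-uniform bound on the energy settling time and on the argmin `s*` of the dissipation
deficit of SOME witness). Why it might fail: near-heteroclinic cycling with passage times growing in
`K`, or slow relaxation at `k ∼ K`, forcing `T₁(K) → ∞` for every witness. Sources:
FoiasManleyRosaTemam2001 Ch. IV; DoeringFoias2002 §2; HolmesLumleyBerkoozRowley2012 §9.2
(doi:10.1017/cbo9780511919701); KanedaEtAl2003; stmt-AnomalousDissipation-0215; cards
hyperfinite-hull-one-loeb-measure (N3), cycling-loophole-rate-vs-level. -/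
def Sig.stub_uniformSettling : Prop :=
  ∀ (ν : ℝ), 0 < ν → ∀ (N : ℕ) (g : ℤ³ → ℂ³), IsConjSymm g → (∀ k, k ∉ freqBall N → g k = 0) →
    g 0 = 0 → (∀ k : ℤ³, ∑ i, ((k i : ℤ) : ℂ) * g k i = 0) →
    ∀ (E ε : ℝ) (M : ℕ) (B : ℝ), 0 < ε →
      ∃ (T₁ E₁ ε₁ B₁ : ℝ), E₁ < 2 * E ∧ ε < ε₁ ∧
        ∀ (K : ℕ) (S : Finset ℤ³), S = (freqBall K).erase 0 →
          (∃ c : ℝ → ↥S → ℂ³, IsCoeffTrajectory S ν g c ∧ (∀ t, 0 ≤ t → modalEnergy (c t) ≤ B) ∧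
              longTimeAvgSup (fun t => modalEnergy (c t)) ≤ E ∧
              2 * ε ≤ longTimeAvgInf (fun t => resolvedDissipation ν M (c t))) →
          ∃ c : ℝ → ↥S → ℂ³, IsCoeffTrajectory S ν g c ∧ (∀ t, 0 ≤ t → modalEnergy (c t) ≤ B₁) ∧
              ∀ T : ℝ, T₁ ≤ T →
                timeMean (fun t => modalEnergy (c t)) T ≤ E₁ ∧
                ε₁ ≤ timeMean (fun t => resolvedDissipation ν M (c t)) T

/-- STUB 3 — A TAME RESTART COSTS ONLY THE MARGINS (provable now, M). For `ν > 0`, admissible `g`,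
`E`, `ε > 0`, `M` and any `(T₁, E₁, ε₁, B₁)` with `E₁ < 2E`, `ε < ε₁` there are `T₀`, `R` — depending
on these data and on `G_N² = Σ_{freqBall N}‖g k‖²`, NOT on `K` — such that for every `K`,
`S = freqBall K ∖ {0}`: a trajectory in the ball `B₁` whose running means obey `(E₁, ε₁)` from `T₁` on
yields a trajectory from a datum with `Σ(1+|k|²)‖c(0)_k‖² ≤ R` whose running means obey `(2E, ε)`
from `T₀` on. Intended proof: energy identity on `[0, 1]` (`galerkin_energy_identity`,
`toReal_eGradNormSq_coeffExt`) bounds `4π²ν∫₀¹Σ|k|²‖c_k‖² ≤ B₁/2 + G_N√B₁`, so some `s ∈ [0,1]` is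
tame, `R := B₁ + (B₁/2 + G_N√B₁)/(4π²ν)`; restart at `s` (`IsGalerkinODESolution.comp_add`); the
restarted means differ from the old ones by at most `E₁/T` resp. `D_max/T`, `D_max = 4π²νM²B₁`
(`timeMean_comp_add_right`), absorbed by the margins for
`T ≥ T₀ := max T₁ 0 + 1 + E₁⁺/(2E − E₁) + D_max/(ε₁ − ε)`. Degenerate data (`E₁ < 0`, `B₁ < 0`,
`T₁ ≤ 0`) make the hypothesis unsatisfiable. Sources: RobinsonRodrigoSadowski2016 Thm 4.4 (4.6)–(4.7);
FoiasManleyRosaTemam2001 Ch. II (7.16)–(7.17) (restart at a positive time to gain an `H¹` datum);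
tree `LongTimeAverageShift.lean`. -/
def Sig.stub_tameRestart : Prop :=
  ∀ (ν : ℝ), 0 < ν → ∀ (N : ℕ) (g : ℤ³ → ℂ³), IsConjSymm g → (∀ k, k ∉ freqBall N → g k = 0) →
    g 0 = 0 → (∀ k : ℤ³, ∑ i, ((k i : ℤ) : ℂ) * g k i = 0) →
    ∀ (E ε : ℝ) (M : ℕ), 0 < ε → ∀ (T₁ E₁ ε₁ B₁ : ℝ), E₁ < 2 * E → ε < ε₁ →
      ∃ (T₀ R : ℝ), ∀ (K : ℕ) (S : Finset ℤ³), S = (freqBall K).erase 0 →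
        (∃ c : ℝ → ↥S → ℂ³, IsCoeffTrajectory S ν g c ∧ (∀ t, 0 ≤ t → modalEnergy (c t) ≤ B₁) ∧
            ∀ T : ℝ, T₁ ≤ T →
              timeMean (fun t => modalEnergy (c t)) T ≤ E₁ ∧
              ε₁ ≤ timeMean (fun t => resolvedDissipation ν M (c t)) T) →
        ∃ c : ℝ → ↥S → ℂ³, IsCoeffTrajectory S ν g c ∧ h1Size (c 0) ≤ R ∧
            ∀ T : ℝ, T₀ ≤ T →
              timeMean (fun t => modalEnergy (c t)) T ≤ 2 * E ∧
              ε ≤ timeMean (fun t => resolvedDissipation ν M (c t)) T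

/-! ### §2 Registered stubs -/

/-- Registered stub 1 (absorbing ball + shift; provable now). -/
theorem stub_absorbedWitness : Sig.stub_absorbedWitness := by
  sorry

/-- Registered stub 2 (the residue: `K`-uniform two-sided settling; load-bearing, hardest). -/
theorem stub_uniformSettling : Sig.stub_uniformSettling := by
  sorry

/-- Registered stub 3 (tame restart at a small-enstrophy instant; provable now). -/
theorem stub_tameRestart : Sig.stub_tameRestart := by
  sorry

/-! ### §3 Composition -/

/-- **The line closes the crux BY NAME modulo the three registered stubs.** Fix the crux's data
`(ν, N, g, E, ε, M)`; stub 1 gives the `K`-uniform ball `B`; stub 2 at `(E, ε, M, B)` gives the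
`K`-uniform settling data `(T₁, E₁, ε₁, B₁)` with `E₁ < 2E`, `ε < ε₁`; stub 3 at those gives
`(T₀, R)`. For any `K`, `S` the crux premise is (after naming its lambda terms) the premise of stub 1,
whose output feeds stub 2, whose output feeds stub 3, whose output is the crux's conclusion verbatim.
[bookkeeping] -/
theorem UniformEquilibration_of :
    Sig.stub_absorbedWitness → Sig.stub_uniformSettling → Sig.stub_tameRestart →
      Summit.AnomalousDissipation.AnomalousDissipation.Theses.DecimationAxis.UniformEquilibration := by
  intro h₁ h₂ h₃
  dsimp only [Summit.AnomalousDissipation.AnomalousDissipation.Theses.DecimationAxis.UniformEquilibration]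
  intro ν hν N g hcs hsupp hg0 htr E ε M hε
  obtain ⟨B, hball⟩ := h₁ ν hν N g hcs hsupp hg0 htr
  obtain ⟨T₁, E₁, ε₁, B₁, hE₁, hε₁, hsettle⟩ := h₂ ν hν N g hcs hsupp hg0 htr E ε M B hε
  obtain ⟨T₀, R, hrestart⟩ := h₃ ν hν N g hcs hsupp hg0 htr E ε M hε T₁ E₁ ε₁ B₁ hE₁ hε₁
  refine ⟨T₀, R, fun K S hS hprem => ?_⟩
  obtain ⟨c, hmem, hcont, hderiv, hsup, hinf⟩ := hprem
  obtain ⟨c', ⟨hmem', hcont', hderiv'⟩, hR', hmeans'⟩ :=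
    hrestart K S hS (hsettle K S hS (hball E ε M K S hS ⟨c, ⟨hmem, hcont, hderiv⟩, hsup, hinf⟩))
  exact ⟨c', hmem', hcont', hderiv', hR', hmeans'⟩

/-- The skeleton in its final shape (D-0027 §3.3): the crux BY NAME from the three registered stubs;
it becomes the crux proof when the last `stub_*` is discharged (until then it depends on `sorryAx`
through the stubs only — no `sorry` of its own). -/
theorem UniformEquilibration_proof :
    Summit.AnomalousDissipation.AnomalousDissipation.Theses.DecimationAxis.UniformEquilibration :=
  UniformEquilibration_of stub_absorbedWitness stub_uniformSettling stub_tameRestart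

end Summit.AnomalousDissipation.AnomalousDissipation.Cruxes.UniformEquilibration.Birth

end
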